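import Mathlib

/-!
# `NoHeavyLowerTail` (crux stmt-CriticalPhenomena-4575), lane prim-ineq-gen-4 (gen 23): the antipodal involution on a simplicial complex

Support file (`--supports stmt-CriticalPhenomena-4575`; memo `run/shared/lean/prim/prim-ineq-gen-4/FINDING-HODGE-FORM-g23.md` §9).
No definitions, no `sorry`, standard axioms.

For a lower family `L` of finite sets (a simplicial complex: `a ∈ L, b ⊆ a ⇒ b ∈ L`) the signed co-zeta matrix
`J[u,a] = (−1)^{#u} [u ⊆ a]` (indexed by `L × L`) is an INVOLUTION, `J * J = 1`, and its trace is the alternating face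
count `Σ_{u ∈ L} (−1)^{#u}`.  Consequently its `±1`-eigenspaces — the antipodally even / odd face polynomials of the memo —
have dimensions (#even faces, #odd faces); this is the dimension count behind the 'antipodal frame' of §9 (the frame criterion
itself is `AntiBandFrameCriterion.det_submatrix_ne_zero_of_frame`, gen 22).
-/

namespace Summit.CriticalPhenomena.PercolationContinuityZ3.Theorems.AntiBandAntipodal

open Finset Matrix

/-- Möbius step on a Boolean interval: for `T ⊆ U`, `Σ_{T ⊆ S ⊆ U} (−1)^{#S} = (−1)^{#T}·[U = T]`. [folklore] -/
theorem sum_interval_neg_one_pow_card {ι : Type*} [DecidableEq ι] {T U : Finset ι} (hTU : T ⊆ U) :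
    ∑ S ∈ U.powerset.filter (fun S => T ⊆ S), (-1 : ℚ) ^ #S = if U = T then (-1 : ℚ) ^ #T else 0 := by
  have key : ∑ S ∈ U.powerset.filter (fun S => T ⊆ S), (-1 : ℚ) ^ #S =
      ∑ V ∈ (U \ T).powerset, (-1 : ℚ) ^ #T * (-1 : ℚ) ^ #V := by
    refine Finset.sum_nbij' (fun S => S \ T) (fun V => T ∪ V) ?_ ?_ ?_ ?_ ?_
    · intro S hS
      obtain ⟨hSU, -⟩ := Finset.mem_filter.mp hS
      exact Finset.mem_powerset.mpr (Finset.sdiff_subset_sdiff (Finset.mem_powerset.mp hSU) le_rfl)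
    · intro V hV
      have hV' : V ⊆ U \ T := Finset.mem_powerset.mp hV
      refine Finset.mem_filter.mpr ⟨Finset.mem_powerset.mpr ?_, Finset.subset_union_left⟩
      exact Finset.union_subset hTU (hV'.trans Finset.sdiff_subset)
    · intro S hS
      obtain ⟨-, hTS⟩ := Finset.mem_filter.mp hS
      exact Finset.union_sdiff_of_subset hTS
    · intro V hV
      have hV' : V ⊆ U \ T := Finset.mem_powerset.mp hV
      have hdis : Disjoint T V := Finset.disjoint_of_subset_right hV' Finset.disjoint_sdiff
      exact Finset.union_sdiff_cancel_left hdis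
    · intro S hS
      obtain ⟨-, hTS⟩ := Finset.mem_filter.mp hS
      rw [← pow_add, Finset.card_sdiff_of_subset hTS, Nat.add_sub_cancel' (Finset.card_le_card hTS)]
  rw [key, ← Finset.mul_sum]
  have h := congrArg (fun z : ℤ => (z : ℚ)) (Finset.sum_powerset_neg_one_pow_card (x := U \ T))
  simp only [Int.cast_sum, Int.cast_pow, Int.cast_neg, Int.cast_one] at h
  rw [h]
  by_cases hUT : U = T
  · subst hUT
    simp
  · have hne : ¬ U \ T = ∅ := by
      intro hemp
      exact hUT (Finset.Subset.antisymm (Finset.sdiff_eq_empty_iff_subset.mp hemp) hTU)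
    simp [hUT, hne]

/-- **The antipodal involution.** For a lower family `L` of finite sets, the signed co-zeta matrix
`J[u,a] = (−1)^{#u}·[u ⊆ a]` on `L × L` satisfies `J * J = 1`. [gen 23, FINDING-HODGE-FORM-g23.md §9.2] -/
theorem signedCoZeta_mul_self {α : Type*} [DecidableEq α] (L : Finset (Finset α))
    (hL : ∀ a ∈ L, ∀ b, b ⊆ a → b ∈ L) :
    (Matrix.of fun (u a : L) => if (u : Finset α) ⊆ a then (-1 : ℚ) ^ #(u : Finset α) else 0) *
      (Matrix.of fun (u a : L) => if (u : Finset α) ⊆ a then (-1 : ℚ) ^ #(u : Finset α) else 0) = 1 := by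
  ext u w
  rw [Matrix.mul_apply, Matrix.one_apply]
  simp only [Matrix.of_apply]
  -- rewrite the sum over the subtype as a sum over the finset L
  rw [show (∑ v : L, (if (u : Finset α) ⊆ (v : Finset α) then (-1 : ℚ) ^ #(u : Finset α) else 0) *
      (if (v : Finset α) ⊆ (w : Finset α) then (-1 : ℚ) ^ #(v : Finset α) else 0)) =
      ∑ v ∈ L, (if (u : Finset α) ⊆ v then (-1 : ℚ) ^ #(u : Finset α) else 0) *
        (if v ⊆ (w : Finset α) then (-1 : ℚ) ^ #v else 0) from
    Finset.sum_coe_sort L (fun v => (if (u : Finset α) ⊆ v then (-1 : ℚ) ^ #(u : Finset α) else 0) *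
        (if v ⊆ (w : Finset α) then (-1 : ℚ) ^ #v else 0))]
  -- only the interval u ⊆ v ⊆ w contributes, and all of it lies in L
  have hset : ∑ v ∈ L, (if (u : Finset α) ⊆ v then (-1 : ℚ) ^ #(u : Finset α) else 0) *
        (if v ⊆ (w : Finset α) then (-1 : ℚ) ^ #v else 0) =
      ∑ v ∈ (w : Finset α).powerset.filter (fun S => (u : Finset α) ⊆ S),
        (-1 : ℚ) ^ #(u : Finset α) * (-1 : ℚ) ^ #v := by
    rw [← Finset.sum_filter_add_sum_filter_not L (fun v => (u : Finset α) ⊆ v ∧ v ⊆ (w : Finset α))]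
    have hz : ∑ v ∈ L.filter (fun v => ¬ ((u : Finset α) ⊆ v ∧ v ⊆ (w : Finset α))),
        (if (u : Finset α) ⊆ v then (-1 : ℚ) ^ #(u : Finset α) else 0) *
          (if v ⊆ (w : Finset α) then (-1 : ℚ) ^ #v else 0) = 0 := by
      refine Finset.sum_eq_zero fun v hv => ?_
      obtain ⟨-, hv⟩ := Finset.mem_filter.mp hv
      by_cases h1 : (u : Finset α) ⊆ v
      · have h2 : ¬ v ⊆ (w : Finset α) := fun h2 => hv ⟨h1, h2⟩
        simp [h2]
      · simp [h1]
    rw [hz, add_zero]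
    refine Finset.sum_congr ?_ fun v hv => ?_
    · ext v
      simp only [Finset.mem_filter, Finset.mem_powerset]
      constructor
      · rintro ⟨-, h1, h2⟩
        exact ⟨h2, h1⟩
      · rintro ⟨h2, h1⟩
        exact ⟨hL _ w.2 _ h2, h1, h2⟩
    · obtain ⟨hvw, h1⟩ := Finset.mem_filter.mp hv
      have h2 : v ⊆ (w : Finset α) := Finset.mem_powerset.mp hvw
      simp [h1, h2]
  rw [hset, ← Finset.mul_sum]
  by_cases huw : (u : Finset α) ⊆ (w : Finset α)
  · rw [sum_interval_neg_one_pow_card huw]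
    by_cases heq : u = w
    · subst heq
      simp only [if_true, ← pow_add, ← two_mul, pow_mul, neg_one_sq, one_pow]
    · have hne : (w : Finset α) ≠ (u : Finset α) := fun h => heq (Subtype.ext h.symm)
      simp [hne, heq]
  · -- u ⊄ w: the interval is empty and u ≠ w
    have hne : u ≠ w := fun h => huw (h ▸ le_rfl)
    have hemp : (w : Finset α).powerset.filter (fun S => (u : Finset α) ⊆ S) = ∅ := by
      ext v
      simp only [Finset.mem_filter, Finset.mem_powerset, Finset.notMem_empty, iff_false, not_and]
      exact fun hvw huv => huw (huv.trans hvw)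
    simp [hemp, hne]

/-- **Trace of the antipodal involution** = the alternating face count `Σ_{u∈L} (−1)^{#u}` (so the `±1`-eigenspaces have
dimensions #even and #odd faces). [gen 23, FINDING-HODGE-FORM-g23.md §9.2] -/
theorem signedCoZeta_trace {α : Type*} [DecidableEq α] (L : Finset (Finset α)) :
    Matrix.trace (Matrix.of fun (u a : L) => if (u : Finset α) ⊆ a then (-1 : ℚ) ^ #(u : Finset α) else 0) =
      ∑ u ∈ L, (-1 : ℚ) ^ #u := by
  rw [Matrix.trace]
  simp only [Matrix.diag_apply, Matrix.of_apply, subset_refl, if_true]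
  exact Finset.sum_coe_sort L (fun u => (-1 : ℚ) ^ #u)

end Summit.CriticalPhenomena.PercolationContinuityZ3.Theorems.AntiBandAntipodal
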